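import Mathlib

/-!
# PneNP / OverlapGapAlgebra — crux `SolvableImpliesStableSection` (stmt-PneNP-2463):
# the FILTERED REPAIR block (1/6) — the rule, its locality, and the shape of a violated clause

Support for crux `stmt-PneNP-2463` (`Summit.PneNP.PneNP.Theses.OverlapGapAlgebra.SolvableImpliesStableSection`).
Instances are `Φ : Fin m → Fin k → Fin n × Bool` (`m` clauses of `k` literals, a literal = (variable,
sign), sign `false` = negative; the baseline assignment is all-`false`, so the violated clauses of the
baseline are the all-positive ones).  A clause content `c` is CRITICAL for the variable `v` when it has a
negative literal and all its negative literals sit on `v` (flipping `v` alone would violate it).  The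
FILTERED REPAIR map flips `v` iff `v` is the first variable of some all-positive clause AND no clause is
critical for `v`:
`g Φ v = true ↔ (∃ a, (Φ a 0).1 = v ∧ ∀ j, (Φ a j).2 = true) ∧ ¬ ∃ a, Crit (Φ a) v`.
Compared with the unfiltered repair map of line `Sketch` v4 (`stub_repairAssembly`), the safety filter
makes one round of repair beat the constant section at EVERY density (file `…FilteredRepairAssembly`).

* `sissF_crit_unique` — a clause content is critical for at most one variable;
* `sissF_local` — the rule is radius-`0` local: `g Φ v` only depends on the clauses containing `v`;
* `sissF_viol_cases` — a clause violated AFTER the round is either all-positive with its first variable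
  made unsafe by another clause, or has two negative literals on distinct variables, every negative
  variable being the first variable of another all-positive clause and critical for no other clause.
No new definitions; axioms `propext`, `Classical.choice`, `Quot.sound`.
-/

set_option linter.dupNamespace false -- `Summit.PneNP.PneNP.…`: summit = sub-problem (D-0017)

namespace Summit.PneNP.PneNP.Theorems

open Finset
open scoped Classical

section FilteredRepairLocal

variable {k m n : ℕ}

/-- A clause content is critical for at most one variable. -/
theorem sissF_crit_unique (c : Fin k → Fin n × Bool) (v w : Fin n)
    (hv : (∃ j, (c j).2 = false) ∧ ∀ j, (c j).2 = false → (c j).1 = v)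
    (hw : (∃ j, (c j).2 = false) ∧ ∀ j, (c j).2 = false → (c j).1 = w) : v = w := by
  obtain ⟨⟨j, hj⟩, hv⟩ := hv
  exact (hv j hj).symm.trans (hw.2 j hj)

/-- An all-positive clause content is critical for no variable. -/
theorem sissF_not_crit_of_allPos (c : Fin k → Fin n × Bool) (v : Fin n) (hall : ∀ j, (c j).2 = true) :
    ¬ ((∃ j, (c j).2 = false) ∧ ∀ j, (c j).2 = false → (c j).1 = v) := by
  rintro ⟨⟨j, hj⟩, -⟩
  have := hall j
  rw [hj] at this
  exact Bool.false_ne_true this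

/-- A clause content critical for `v` contains the variable `v`. -/
theorem sissF_mem_of_crit (c : Fin k → Fin n × Bool) (v : Fin n)
    (hv : (∃ j, (c j).2 = false) ∧ ∀ j, (c j).2 = false → (c j).1 = v) : ∃ j, (c j).1 = v := by
  obtain ⟨⟨j, hj⟩, hv⟩ := hv
  exact ⟨j, hv j hj⟩

/-- **The filtered repair map is radius-`0` local.** If two instances agree on every clause that
contains the variable `v` (in either instance), the map takes the same value at `v`. -/
theorem sissF_local (hk : 0 < k) (g : (Fin m → Fin k → Fin n × Bool) → (Fin n → Bool))
    (hg : ∀ (Φ : Fin m → Fin k → Fin n × Bool) (v : Fin n),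
      g Φ v = true ↔ (∃ a : Fin m, (Φ a ⟨0, hk⟩).1 = v ∧ ∀ j, (Φ a j).2 = true) ∧
        ¬ ∃ a : Fin m, (∃ j, (Φ a j).2 = false) ∧ ∀ j, (Φ a j).2 = false → (Φ a j).1 = v)
    (Φ Φ' : Fin m → Fin k → Fin n × Bool) (v : Fin n)
    (H : ∀ i : Fin m, ((∃ j, (Φ i j).1 = v) ∨ (∃ j, (Φ' i j).1 = v)) → Φ i = Φ' i) :
    g Φ v = g Φ' v := by
  -- both defining predicates are invariant under the exchange `Φ ↔ Φ'`
  have hdes : (∃ a : Fin m, (Φ a ⟨0, hk⟩).1 = v ∧ ∀ j, (Φ a j).2 = true) ↔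
      (∃ a : Fin m, (Φ' a ⟨0, hk⟩).1 = v ∧ ∀ j, (Φ' a j).2 = true) := by
    constructor
    · rintro ⟨a, ha, hall⟩
      have he : Φ a = Φ' a := H a (Or.inl ⟨_, ha⟩)
      exact ⟨a, by rw [← he]; exact ha, by rw [← he]; exact hall⟩
    · rintro ⟨a, ha, hall⟩
      have he : Φ a = Φ' a := H a (Or.inr ⟨_, ha⟩)
      exact ⟨a, by rw [he]; exact ha, by rw [he]; exact hall⟩
  have hcrit : (∃ a : Fin m, (∃ j, (Φ a j).2 = false) ∧ ∀ j, (Φ a j).2 = false → (Φ a j).1 = v) ↔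
      (∃ a : Fin m, (∃ j, (Φ' a j).2 = false) ∧ ∀ j, (Φ' a j).2 = false → (Φ' a j).1 = v) := by
    constructor
    · rintro ⟨a, ha⟩
      have he : Φ a = Φ' a := H a (Or.inl (sissF_mem_of_crit _ _ ha))
      exact ⟨a, by rw [← he]; exact ha⟩
    · rintro ⟨a, ha⟩
      have he : Φ a = Φ' a := H a (Or.inr (sissF_mem_of_crit _ _ ha))
      exact ⟨a, by rw [he]; exact ha⟩
  rw [Bool.eq_iff_iff, hg, hg, hdes, hcrit]

/-- **Shape of a clause violated after the round.** If clause `i` is violated by the filtered repair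
map, then EITHER it is all-positive and some other clause is critical for its first variable, OR it is
not all-positive, every negative literal of it sits on a variable that is the first variable of another
all-positive clause and is critical for no other clause, and two of its negative literals sit on
distinct variables. -/
theorem sissF_viol_cases {k m n : ℕ} (hk : 0 < k) (g : (Fin m → Fin k → Fin n × Bool) → (Fin n → Bool))
    (hg : ∀ (Φ : Fin m → Fin k → Fin n × Bool) (v : Fin n),
      g Φ v = true ↔ (∃ a : Fin m, (Φ a ⟨0, hk⟩).1 = v ∧ ∀ j, (Φ a j).2 = true) ∧
        ¬ ∃ a : Fin m, (∃ j, (Φ a j).2 = false) ∧ ∀ j, (Φ a j).2 = false → (Φ a j).1 = v)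
    (Φ : Fin m → Fin k → Fin n × Bool) (i : Fin m) (hviol : ∀ j, g Φ (Φ i j).1 ≠ (Φ i j).2) :
    ((∀ j, (Φ i j).2 = true) ∧ ∃ a : Fin m, a ≠ i ∧
        (∃ j, (Φ a j).2 = false) ∧ ∀ j, (Φ a j).2 = false → (Φ a j).1 = (Φ i ⟨0, hk⟩).1) ∨
    ((¬ ∀ j, (Φ i j).2 = true) ∧
      (∀ j, (Φ i j).2 = false →
        (∃ a : Fin m, a ≠ i ∧ (Φ a ⟨0, hk⟩).1 = (Φ i j).1 ∧ ∀ j', (Φ a j').2 = true) ∧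
        ∀ a : Fin m, a ≠ i →
          ¬ ((∃ j', (Φ a j').2 = false) ∧ ∀ j', (Φ a j').2 = false → (Φ a j').1 = (Φ i j).1)) ∧
      ∃ j j', (Φ i j).2 = false ∧ (Φ i j').2 = false ∧ (Φ i j).1 ≠ (Φ i j').1) := by
  by_cases hall : ∀ j, (Φ i j).2 = true
  · -- all-positive: the first variable is designated by `i` itself, hence it must be unsafe
    refine Or.inl ⟨hall, ?_⟩
    have h0 : g Φ (Φ i ⟨0, hk⟩).1 = false := by
      have := hviol ⟨0, hk⟩
      rw [hall] at this
      simpa using this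
    have hnot : ¬ (g Φ (Φ i ⟨0, hk⟩).1 = true) := by rw [h0]; exact Bool.false_ne_true
    rw [hg] at hnot
    have hunsafe : ∃ a : Fin m, (∃ j, (Φ a j).2 = false) ∧
        ∀ j, (Φ a j).2 = false → (Φ a j).1 = (Φ i ⟨0, hk⟩).1 := by
      by_contra hsafe
      exact hnot ⟨⟨i, rfl, hall⟩, hsafe⟩
    obtain ⟨a, ha⟩ := hunsafe
    refine ⟨a, ?_, ha⟩
    rintro rfl
    exact sissF_not_crit_of_allPos _ _ hall ha
  · -- not all-positive: every negative variable is flipped, i.e. designated elsewhere and safe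
    have hneg : ∀ j, (Φ i j).2 = false →
        (∃ a : Fin m, (Φ a ⟨0, hk⟩).1 = (Φ i j).1 ∧ ∀ j', (Φ a j').2 = true) ∧
        ¬ ∃ a : Fin m, (∃ j', (Φ a j').2 = false) ∧
          ∀ j', (Φ a j').2 = false → (Φ a j').1 = (Φ i j).1 := by
      intro j hj
      have h1 : g Φ (Φ i j).1 = true := by
        have := hviol j
        rw [hj] at this
        simpa using this
      exact (hg Φ _).1 h1
    refine Or.inr ⟨hall, fun j hj => ?_, ?_⟩
    · obtain ⟨⟨a, ha, hapos⟩, hsafe⟩ := hneg j hj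
      refine ⟨⟨a, ?_, ha, hapos⟩, fun a' _ h => hsafe ⟨a', h⟩⟩
      rintro rfl
      exact hall hapos
    · -- two negative literals on distinct variables, else clause `i` is critical for the common one
      obtain ⟨j₀, hj₀⟩ : ∃ j, (Φ i j).2 = false := by
        by_contra h
        push Not at h
        exact hall fun j => by simpa using h j
      by_contra hpair
      push Not at hpair
      have hcrit : (∃ j', (Φ i j').2 = false) ∧
          ∀ j', (Φ i j').2 = false → (Φ i j').1 = (Φ i j₀).1 :=
        ⟨⟨j₀, hj₀⟩, fun j' hj' => hpair j' j₀ hj' hj₀⟩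
      exact (hneg j₀ hj₀).2 ⟨i, hcrit⟩

end FilteredRepairLocal

end Summit.PneNP.PneNP.Theorems
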